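import Mathlib.Analysis.SpecialFunctions.Pow.Real
import Mathlib.Analysis.Complex.ExponentialBounds
import HarnessLib

/-!
# Matomäki–Merikoski §7: the choice `u = min{√(V log η)/(10C), log η}` makes every error term acceptable

Topic `Literature/Barriers/Parity`; sibling of the `SiegelZeroPrimePairs*` files.  Everything here is PROVED
(theorems only; pure real analysis).  In §7 of Matomäki–Merikoski (IMRN 2023; arXiv:2112.11412, p. 20,
(7.1)–(7.2) and the two "the error terms are acceptable by our choice of `u`" paragraphs) the sieving level is
`z = X^{1/u}` with

  `u = min{ √(V log η)/(10C), log η }`,   `V = log X/log q`,                                   (7.2)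

and the target error of Theorem 1.3 is `T = exp(−C √(V log η)) + V log⁶η/η` (plus the `u`-independent
`exp(−C log^{3/5−ε} X)`).  This file verifies, once and for all, that under the standing hypotheses of the
core regime (`η` large, `η ≤ q^{1/100}` — the source's "`η ≪ q^ε`" (1.3) —, `X ≥ q^{37/4}`) each of the error
terms met in §7 is `≤ K · T` with an absolute `K`:

  `u⁸/(V² η^{V/(3u)})`, `u⁶V/η`, `u^{10} z^{−1/2}`, `(z + log q) log²X / X`, `e^{−Au/3000}` (`A = 10⁶C²`),
  `u⁶/z`, `X^{−2/9+3/1000} q²`, `u⁴/(v²η^{v/2})` and `v u⁵/η` (`v = V/u`), `u⁴/√q`,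

together with `u₀ ≤ u ≤ log η` for any prescribed `u₀` (`MatomakiMerikoski.MatomakiMerikoski2023_parameters`).
The two regimes of the minimum are treated as in the source: if `u = √(V log η)/(10C)` then
`log X/u ≥ 1000 C √(V log η)` (using `log q ≥ 100 log η`) and everything is `≪ exp(−C√(V log η))`
(`regimeA_bounds`); if `u = log η` then `V > 100C² log η`, `X^{−1/u} ≤ q^{−100C²}` and everything is `≪ 1/η`
(`regimeB_bounds`).  (The one term that genuinely needs `η ≤ q^{ε}` with a SMALL `ε` is `X^{−2/9+3/1000}q²`:
with `V ≥ 37/4` it is `≤ q^{−0.0278}`, which is `≤ 1/η` once `log η ≤ (1/100) log q`.)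

## References

* K. Matomäki, J. Merikoski, IMRN 2023:23, 20337–20384 (arXiv:2112.11412), §7, (7.1)–(7.2) and the error
  bookkeeping after (7.2) and after the displays for `Σ_{S,S}`, `Σ_{L,L}`, `Σ_{S,L}`. [cite: MatomakiMerikoski2023, §7 (7.2)]
-/

noncomputable section

open Real

namespace Literature.Barriers.Parity.MatomakiMerikoski

/-! ### Polynomial times decaying exponential -/

/-- `t^k e^{−a t} ≤ k!/a^k` for `t ≥ 0`, `a > 0`. [folklore] -/
theorem pow_mul_exp_neg_mul_le (k : ℕ) {a : ℝ} (ha : 0 < a) {t : ℝ} (ht : 0 ≤ t) :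
    t ^ k * Real.exp (-(a * t)) ≤ (k.factorial : ℝ) / a ^ k := by
  have h := Real.pow_div_factorial_le_exp (a * t) (mul_nonneg ha.le ht) k
  have hfac : (0 : ℝ) < k.factorial := by exact_mod_cast Nat.factorial_pos k
  have hak : 0 < a ^ k := pow_pos ha k
  rw [div_le_iff₀ hfac, mul_pow] at h
  have hexp : 0 < Real.exp (a * t) := Real.exp_pos _
  rw [le_div_iff₀ hak, Real.exp_neg]
  calc t ^ k * (Real.exp (a * t))⁻¹ * a ^ k = (a ^ k * t ^ k) * (Real.exp (a * t))⁻¹ := by ring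
    _ ≤ (Real.exp (a * t) * k.factorial) * (Real.exp (a * t))⁻¹ :=
        mul_le_mul_of_nonneg_right h (inv_nonneg.mpr hexp.le)
    _ = k.factorial := by field_simp

/-- Trading one unit of exponential decay for a polynomial: `S^k e^{−bS} ≤ k! e^{−cS}` whenever `S ≥ 0` and
`c + 1 ≤ b`. [folklore] -/
theorem pow_mul_exp_le_factorial_mul_exp (k : ℕ) {b c S : ℝ} (hS : 0 ≤ S) (hcb : c + 1 ≤ b) :
    S ^ k * Real.exp (-(b * S)) ≤ (k.factorial : ℝ) * Real.exp (-(c * S)) := by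
  have hbc : 1 ≤ b - c := by linarith
  have h1 := pow_mul_exp_neg_mul_le k (by linarith : 0 < b - c) hS
  have hfac : (0 : ℝ) ≤ k.factorial := by exact_mod_cast (Nat.factorial_pos k).le
  have h2 : (k.factorial : ℝ) / (b - c) ^ k ≤ k.factorial :=
    div_le_self hfac (one_le_pow₀ hbc)
  have e : S ^ k * Real.exp (-(b * S)) = (S ^ k * Real.exp (-((b - c) * S))) * Real.exp (-(c * S)) := by
    rw [mul_assoc, ← Real.exp_add]; congr 1; ring
  rw [e]
  exact mul_le_mul_of_nonneg_right (h1.trans h2) (Real.exp_pos _).le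

/-- A monomial against an exponential with a larger rate: `u^k ≤ S^k`, `rate ≥ (c+1) S` gives
`u^k e^{−rate} ≤ k! e^{−cS}`. [folklore] -/
theorem pow_mul_exp_le_of_le (k : ℕ) {u S c rate : ℝ} (hu0 : 0 ≤ u) (huS : u ≤ S)
    (hrate : (c + 1) * S ≤ rate) :
    u ^ k * Real.exp (-rate) ≤ (k.factorial : ℝ) * Real.exp (-(c * S)) := by
  have hS : 0 ≤ S := hu0.trans huS
  calc u ^ k * Real.exp (-rate) ≤ S ^ k * Real.exp (-((c + 1) * S)) :=
        mul_le_mul (pow_le_pow_left₀ hu0 huS k) (Real.exp_le_exp.mpr (by linarith)) (Real.exp_pos _).le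
          (pow_nonneg hS k)
    _ ≤ (k.factorial : ℝ) * Real.exp (-(c * S)) := pow_mul_exp_le_factorial_mul_exp k hS le_rfl

/-! ### The two regimes -/

/-- **Regime A** (`u = S/(10C)`, `S = √(Vℓ)`): with `log X/u ≥ 1000 C S` the five `u`-dependent error
terms are `≤ k! · e^{−CS}`. [cite: MatomakiMerikoski2023, §7 (7.2)] -/
theorem regimeA_bounds {C S ℓ V u Lx : ℝ} (hC : 1 ≤ C) (hS0 : 0 < S) (hℓ0 : 0 < ℓ) (hV : 37 / 4 ≤ V)
    (hS2 : S ^ 2 = V * ℓ) (hu : u = S / (10 * C)) (hLu : 1000 * C * S ≤ Lx / u) :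
    u ^ 8 * ((V ^ 2)⁻¹ * Real.exp (-(ℓ * (V / (3 * u))))) ≤ (Nat.factorial 8 : ℝ) * Real.exp (-(C * S)) ∧
    u ^ 10 * Real.exp (Lx * (-(1 / (2 * u)))) ≤ (Nat.factorial 10 : ℝ) * Real.exp (-(C * S)) ∧
    u ^ 6 * Real.exp (Lx * (-(1 / u))) ≤ (Nat.factorial 6 : ℝ) * Real.exp (-(C * S)) ∧
    Real.exp (-(10 ^ 6 * C ^ 2 * u / 3000)) ≤ Real.exp (-(C * S)) ∧
    u ^ 4 / ((V / u) ^ 2 * Real.exp (ℓ * (V / u / 2))) ≤ (Nat.factorial 6 : ℝ) * Real.exp (-(C * S)) := by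
  have hC0 : 0 < C := by linarith
  have h10C : 0 < 10 * C := by positivity
  have hu0 : 0 < u := by rw [hu]; positivity
  have huS : u ≤ S := by rw [hu]; exact div_le_self hS0.le (by linarith)
  have hV0 : 0 < V := by linarith
  -- `V/u = 10 C S/ℓ`
  have hVu : V / u = 10 * C * S / ℓ := by
    rw [hu]
    have : V = S ^ 2 / ℓ := by rw [hS2]; field_simp
    rw [this]; field_simp
  have hLx : 1000 * C * S * u ≤ Lx := by rwa [le_div_iff₀ hu0] at hLu
  have hSCS : S ≤ C * S := by nlinarith
  refine ⟨?_, ?_, ?_, ?_, ?_⟩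
  · -- `u⁸ V^{-2} e^{-ℓV/(3u)} ≤ u⁸ e^{-(10C/3) S}`
    have hV2 : (V ^ 2)⁻¹ ≤ 1 := inv_le_one_of_one_le₀ (one_le_pow₀ (by linarith))
    have hrate : ℓ * (V / (3 * u)) = 10 * C / 3 * S := by
      rw [show V / (3 * u) = (V / u) / 3 by field_simp, hVu]; field_simp
    calc u ^ 8 * ((V ^ 2)⁻¹ * Real.exp (-(ℓ * (V / (3 * u)))))
        ≤ u ^ 8 * (1 * Real.exp (-(ℓ * (V / (3 * u))))) := by gcongr
      _ = u ^ 8 * Real.exp (-(10 * C / 3 * S)) := by rw [one_mul, hrate]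
      _ ≤ (Nat.factorial 8 : ℝ) * Real.exp (-(C * S)) :=
          pow_mul_exp_le_of_le 8 hu0.le huS (by nlinarith)
  · have e : Lx * (-(1 / (2 * u))) = -(Lx / u / 2) := by field_simp
    rw [e]
    exact pow_mul_exp_le_of_le 10 hu0.le huS (by linarith [hSCS])
  · have e : Lx * (-(1 / u)) = -(Lx / u) := by field_simp
    rw [e]
    exact pow_mul_exp_le_of_le 6 hu0.le huS (by linarith [hSCS])
  · refine Real.exp_le_exp.mpr ?_
    rw [hu]
    have : 10 ^ 6 * C ^ 2 * (S / (10 * C)) / 3000 = (100 / 3) * (C * S) := by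
      field_simp; norm_num
    rw [this]; nlinarith [mul_pos hC0 hS0]
  · -- `u⁴/((V/u)² e^{ℓ V/(2u)}) = u⁴ ℓ²/(100 C² S²) e^{−5CS} ≤ S⁶ e^{−5CS}`
    have hrate : ℓ * (V / u / 2) = 5 * C * S := by rw [hVu]; field_simp; ring
    have hv2 : (V / u) ^ 2 = 100 * C ^ 2 * S ^ 2 / ℓ ^ 2 := by rw [hVu]; field_simp; ring
    have hℓS : ℓ ≤ S ^ 2 := by nlinarith
    have hℓS2 : ℓ ^ 2 ≤ S ^ 4 := by nlinarith
    have h1 : u ^ 4 / ((V / u) ^ 2 * Real.exp (ℓ * (V / u / 2))) ≤ S ^ 6 * Real.exp (-(5 * C * S)) := by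
      rw [hrate, hv2]
      have hden : 0 < 100 * C ^ 2 * S ^ 2 / ℓ ^ 2 * Real.exp (5 * C * S) := by positivity
      rw [div_le_iff₀ hden]
      have e : S ^ 6 * Real.exp (-(5 * C * S)) * (100 * C ^ 2 * S ^ 2 / ℓ ^ 2 * Real.exp (5 * C * S)) =
          100 * C ^ 2 * (S ^ 8 / ℓ ^ 2) := by
        rw [Real.exp_neg]; field_simp
      rw [e]
      have hC2 : 1 ≤ C ^ 2 := one_le_pow₀ hC
      have hu4 : u ^ 4 ≤ S ^ 4 := pow_le_pow_left₀ hu0.le huS 4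
      have hS4 : 0 ≤ S ^ 4 := by positivity
      have hS8 : S ^ 4 ≤ S ^ 8 / ℓ ^ 2 := by
        rw [le_div_iff₀ (by positivity)]; nlinarith
      nlinarith
    exact h1.trans (pow_mul_exp_le_factorial_mul_exp 6 hS0.le (by linarith))

/-- **Regime B** (`u = ℓ`, `100 C² ℓ ≤ V`): with `log X/u ≥ 10⁴ C² ℓ` the five `u`-dependent error terms are
`≤ k! · e^{−ℓ}`. [cite: MatomakiMerikoski2023, §7 (7.2)] -/
theorem regimeB_bounds {C ℓ V u Lx : ℝ} (hC : 1 ≤ C) (hℓ1 : 1 ≤ ℓ) (hu : u = ℓ) (hVℓ : 100 * C ^ 2 * ℓ ≤ V)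
    (hLu : 10000 * C ^ 2 * ℓ ≤ Lx / u) :
    u ^ 8 * ((V ^ 2)⁻¹ * Real.exp (-(ℓ * (V / (3 * u))))) ≤ (Nat.factorial 8 : ℝ) * Real.exp (-(1 * ℓ)) ∧
    u ^ 10 * Real.exp (Lx * (-(1 / (2 * u)))) ≤ (Nat.factorial 10 : ℝ) * Real.exp (-(1 * ℓ)) ∧
    u ^ 6 * Real.exp (Lx * (-(1 / u))) ≤ (Nat.factorial 6 : ℝ) * Real.exp (-(1 * ℓ)) ∧
    Real.exp (-(10 ^ 6 * C ^ 2 * u / 3000)) ≤ Real.exp (-(1 * ℓ)) ∧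
    u ^ 4 / ((V / u) ^ 2 * Real.exp (ℓ * (V / u / 2))) ≤ (Nat.factorial 4 : ℝ) * Real.exp (-(1 * ℓ)) := by
  have hℓ0 : 0 < ℓ := by linarith
  have hC2 : 1 ≤ C ^ 2 := one_le_pow₀ hC
  have hV100 : 100 * ℓ ≤ V := by nlinarith
  have hV1 : 1 ≤ V := by linarith
  have hu0 : 0 < u := by rw [hu]; exact hℓ0
  have hLx : 10000 * C ^ 2 * ℓ * u ≤ Lx := by rwa [le_div_iff₀ hu0] at hLu
  subst hu
  refine ⟨?_, ?_, ?_, ?_, ?_⟩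
  · have hV2 : (V ^ 2)⁻¹ ≤ 1 := inv_le_one_of_one_le₀ (one_le_pow₀ hV1)
    have hrate : u * (V / (3 * u)) = V / 3 := by field_simp
    calc u ^ 8 * ((V ^ 2)⁻¹ * Real.exp (-(u * (V / (3 * u)))))
        ≤ u ^ 8 * (1 * Real.exp (-(u * (V / (3 * u))))) := by gcongr
      _ = u ^ 8 * Real.exp (-(V / 3)) := by rw [one_mul, hrate]
      _ ≤ (Nat.factorial 8 : ℝ) * Real.exp (-(1 * u)) := pow_mul_exp_le_of_le 8 hu0.le le_rfl (by nlinarith)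
  · have e : Lx * (-(1 / (2 * u))) = -(Lx / u / 2) := by field_simp
    rw [e]
    exact pow_mul_exp_le_of_le 10 hu0.le le_rfl (by nlinarith)
  · have e : Lx * (-(1 / u)) = -(Lx / u) := by field_simp
    rw [e]
    exact pow_mul_exp_le_of_le 6 hu0.le le_rfl (by nlinarith)
  · refine Real.exp_le_exp.mpr ?_
    nlinarith [mul_pos (by positivity : (0 : ℝ) < C ^ 2) hℓ0]
  · have hrate : u * (V / u / 2) = V / 2 := by field_simp
    have hv1 : 1 ≤ (V / u) ^ 2 := by
      have : 1 ≤ V / u := by rw [le_div_iff₀ hu0]; linarith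
      exact one_le_pow₀ this
    rw [hrate, div_eq_mul_inv, mul_inv, ← Real.exp_neg]
    calc u ^ 4 * (((V / u) ^ 2)⁻¹ * Real.exp (-(V / 2)))
        ≤ u ^ 4 * (1 * Real.exp (-(V / 2))) := by gcongr; exact inv_le_one_of_one_le₀ hv1
      _ = u ^ 4 * Real.exp (-(V / 2)) := by rw [one_mul]
      _ ≤ (Nat.factorial 4 : ℝ) * Real.exp (-(1 * u)) := pow_mul_exp_le_of_le 4 hu0.le le_rfl (by nlinarith)

/-! ### The bounds that do not depend on the regime -/

/-- `(X^{1/u} + log q) log²X ≤ 80 e^{−ℓ} X` when `u ≥ 2`, `4ℓ ≤ log X`, `log q ≤ log X`. [cite: MatomakiMerikoski2023, §7 (7.1)] -/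
theorem level_term_le {Lx ℓ u lq X : ℝ} (hX : X = Real.exp Lx) (hLx0 : 0 ≤ Lx) (hu2 : 2 ≤ u)
    (h4ℓ : 4 * ℓ ≤ Lx) (hlq : lq ≤ Lx) :
    (Real.exp (Lx * (1 / u)) + lq) * Lx ^ 2 ≤ 80 * Real.exp (-ℓ) * X := by
  have hX0 : 0 < X := by rw [hX]; exact Real.exp_pos _
  have h1 : Real.exp (Lx * (1 / u)) ≤ X * Real.exp (-(Lx / 2)) := by
    rw [hX, ← Real.exp_add]
    refine Real.exp_le_exp.mpr ?_
    have : Lx * (1 / u) ≤ Lx / 2 := by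
      rw [mul_one_div]; exact div_le_div_of_nonneg_left hLx0 (by norm_num) hu2
    linarith
  have f2 : ((2 : ℕ).factorial : ℝ) = 2 := by norm_num [Nat.factorial]
  have f3 : ((3 : ℕ).factorial : ℝ) = 6 := by norm_num [Nat.factorial]
  have h2 : Lx ^ 2 * Real.exp (-(Lx / 2)) ≤ 32 * Real.exp (-(Lx / 4)) := by
    have h := pow_mul_exp_neg_mul_le 2 (by norm_num : (0 : ℝ) < 1 / 4) hLx0
    rw [f2] at h
    have e : Lx ^ 2 * Real.exp (-(Lx / 2)) = (Lx ^ 2 * Real.exp (-(1 / 4 * Lx))) * Real.exp (-(Lx / 4)) := by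
      rw [mul_assoc, ← Real.exp_add]; congr 1; ring
    rw [e]
    exact mul_le_mul_of_nonneg_right (h.trans (by norm_num)) (Real.exp_pos _).le
  have h3 : Lx ^ 3 * Real.exp (-Lx) ≤ 48 * Real.exp (-(Lx / 2)) := by
    have h := pow_mul_exp_neg_mul_le 3 (by norm_num : (0 : ℝ) < 1 / 2) hLx0
    rw [f3] at h
    have e : Lx ^ 3 * Real.exp (-Lx) = (Lx ^ 3 * Real.exp (-(1 / 2 * Lx))) * Real.exp (-(Lx / 2)) := by
      rw [mul_assoc, ← Real.exp_add]; congr 1; ring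
    rw [e]
    exact mul_le_mul_of_nonneg_right (h.trans (by norm_num)) (Real.exp_pos _).le
  have h4 : Real.exp (-(Lx / 4)) ≤ Real.exp (-ℓ) := Real.exp_le_exp.mpr (by linarith)
  have h5 : Real.exp (-(Lx / 2)) ≤ Real.exp (-ℓ) := Real.exp_le_exp.mpr (by linarith)
  have hXe : lq * Lx ^ 2 ≤ X * (Lx ^ 3 * Real.exp (-Lx)) := by
    have e : X * (Lx ^ 3 * Real.exp (-Lx)) = Lx ^ 3 := by
      rw [hX, Real.exp_neg]; field_simp
    rw [e]
    nlinarith [sq_nonneg Lx]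
  calc (Real.exp (Lx * (1 / u)) + lq) * Lx ^ 2 = Real.exp (Lx * (1 / u)) * Lx ^ 2 + lq * Lx ^ 2 := by ring
    _ ≤ X * Real.exp (-(Lx / 2)) * Lx ^ 2 + X * (Lx ^ 3 * Real.exp (-Lx)) :=
        add_le_add (mul_le_mul_of_nonneg_right h1 (by positivity)) hXe
    _ = X * (Lx ^ 2 * Real.exp (-(Lx / 2)) + Lx ^ 3 * Real.exp (-Lx)) := by ring
    _ ≤ X * (32 * Real.exp (-(Lx / 4)) + 48 * Real.exp (-(Lx / 2))) :=
        mul_le_mul_of_nonneg_left (add_le_add h2 h3) hX0.le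
    _ ≤ X * (32 * Real.exp (-ℓ) + 48 * Real.exp (-ℓ)) := by gcongr
    _ = 80 * Real.exp (-ℓ) * X := by ring

/-- `X^{−2/9+3/1000} q² ≤ e^{−ℓ}` when `V = log X/log q ≥ 37/4` and `100 ℓ ≤ log q` (the only place where a
small `ε` in `η ≤ q^ε` is needed). [cite: MatomakiMerikoski2023, §7 (error term `X^{7/9+3/1000}q²`)] -/
theorem geometric_term_le {lq V ℓ : ℝ} (hlq : 100 * ℓ ≤ lq) (hℓ0 : 0 ≤ ℓ) (hV : 37 / 4 ≤ V) :
    Real.exp (lq * ((-(2 : ℝ) / 9 + 3 / 1000) * V + 2)) ≤ Real.exp (-ℓ) := by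
  refine Real.exp_le_exp.mpr ?_
  have hlq0 : 0 ≤ lq := by linarith
  have e2 : (-(2 : ℝ) / 9 + 3 / 1000) * V + 2 ≤ -(1001 / 36000) := by nlinarith
  have : lq * ((-(2 : ℝ) / 9 + 3 / 1000) * V + 2) ≤ lq * (-(1001 / 36000)) :=
    mul_le_mul_of_nonneg_left e2 hlq0
  nlinarith

/-! ### The parameter lemma -/

set_option maxHeartbeats 800000 in
/-- **Matomäki–Merikoski §7, the choice of `u` (7.2).**  For every `C ≥ 1` and every `u₀` there are `K > 0`
and `η₀ > 1` such that for all naturals `q ≥ 3` and reals `η, X` with `η ≥ η₀`, `log η ≤ (log q)/100` and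
`q^{37/4} ≤ X`, writing `V = log X/log q`, `ℓ = log η`, `u = min(√(Vℓ)/(10C), ℓ)` and
`T = exp(−C√(Vℓ)) + V ℓ⁶/η`, one has `u₀ ≤ u`, `0 < u ≤ ℓ`, and each of
`u⁸/(V²η^{V/(3u)})`, `u⁶V/η`, `u^{10} X^{−1/(2u)}`, `(X^{1/u} + log q) log²X / X`, `exp(−10⁶C² u/3000)`,
`u⁶ X^{−1/u}`, `X^{−2/9+3/1000} q²`, `u⁴/((V/u)² η^{V/(2u)})`, `(V/u) u⁵/η`, `u⁴/√q` is `≤ K T`.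
[cite: MatomakiMerikoski2023, §7 (7.2)] -/
theorem MatomakiMerikoski2023_parameters (C u₀ : ℝ) (hC : 1 ≤ C) :
    ∃ K η₀ : ℝ, 0 < K ∧ 1 < η₀ ∧ ∀ (q : ℕ) (η X : ℝ), 3 ≤ q → η₀ ≤ η →
      Real.log η ≤ Real.log q / 100 → (q : ℝ) ^ (37 / 4 : ℝ) ≤ X →
      ∀ V ℓ u T : ℝ, V = Real.log X / Real.log q → ℓ = Real.log η →
        u = min (Real.sqrt (V * ℓ) / (10 * C)) ℓ →
        T = Real.exp (-(C * Real.sqrt (V * ℓ))) + V * ℓ ^ 6 / η →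
        u₀ ≤ u ∧ 0 < u ∧ u ≤ ℓ ∧
        u ^ 8 / (V ^ 2 * η ^ (V / (3 * u))) ≤ K * T ∧
        u ^ 6 * V / η ≤ K * T ∧
        u ^ 10 * X ^ (-(1 / (2 * u))) ≤ K * T ∧
        (X ^ (1 / u) + Real.log q) * Real.log X ^ 2 ≤ K * T * X ∧
        Real.exp (-(10 ^ 6 * C ^ 2 * u / 3000)) ≤ K * T ∧
        u ^ 6 * X ^ (-(1 / u)) ≤ K * T ∧
        X ^ (-(2 : ℝ) / 9 + 3 / 1000) * (q : ℝ) ^ 2 ≤ K * T ∧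
        u ^ 4 / ((V / u) ^ 2 * η ^ (V / u / 2)) ≤ K * T ∧
        V / u * u ^ 5 / η ≤ K * T ∧
        u ^ 4 / Real.sqrt q ≤ K * T := by
  -- constants
  set ℓ₀ : ℝ := 2 + 44 * C ^ 2 + 11 * C ^ 2 * u₀ ^ 2 with hℓ₀
  have hC0 : 0 < C := by linarith
  have hC2 : 1 ≤ C ^ 2 := one_le_pow₀ hC
  have hℓ₀2 : 2 ≤ ℓ₀ := by rw [hℓ₀]; nlinarith [sq_nonneg u₀, sq_nonneg C]
  set K : ℝ := 4000000 with hK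
  have hℓ₀pos : (0 : ℝ) < ℓ₀ := by linarith
  have hexpℓ₀ : 1 < Real.exp ℓ₀ := by
    calc (1 : ℝ) = Real.exp 0 := Real.exp_zero.symm
      _ < Real.exp ℓ₀ := Real.exp_lt_exp.mpr hℓ₀pos
  refine ⟨K, Real.exp ℓ₀, by norm_num, hexpℓ₀, ?_⟩
  intro q η X hq hη hηq hX V ℓ u T hVdef hℓdef hudef hTdef
  -- factorials
  have f4 : ((4 : ℕ).factorial : ℝ) = 24 := by norm_num [Nat.factorial]
  have f6 : ((6 : ℕ).factorial : ℝ) = 720 := by norm_num [Nat.factorial]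
  have f8 : ((8 : ℕ).factorial : ℝ) = 40320 := by norm_num [Nat.factorial]
  have f10 : ((10 : ℕ).factorial : ℝ) = 3628800 := by norm_num [Nat.factorial]
  -- `q`
  have hq3 : (3 : ℝ) ≤ q := by exact_mod_cast hq
  have hq0 : (0 : ℝ) < q := by linarith
  have hlogq0 : 0 < Real.log q := Real.log_pos (by linarith)
  -- `η`, `ℓ`
  have hη1 : 1 < η := lt_of_lt_of_le hexpℓ₀ hη
  have hη0 : 0 < η := by linarith
  have hℓℓ₀ : ℓ₀ ≤ ℓ := by rw [hℓdef, Real.le_log_iff_exp_le hη0]; exact hη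
  have hℓ2 : 2 ≤ ℓ := hℓ₀2.trans hℓℓ₀
  have hℓ1 : 1 ≤ ℓ := by linarith
  have hℓ0 : 0 < ℓ := by linarith
  have hηexp : η = Real.exp ℓ := by rw [hℓdef, Real.exp_log hη0]
  have hlq : 100 * ℓ ≤ Real.log q := by rw [hℓdef]; linarith
  -- `X`, `V`
  have hqpow : 0 < (q : ℝ) ^ (37 / 4 : ℝ) := Real.rpow_pos_of_pos hq0 _
  have hX0 : 0 < X := lt_of_lt_of_le hqpow hX
  have hlogX : 37 / 4 * Real.log q ≤ Real.log X := by
    have := Real.log_le_log hqpow hX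
    rwa [Real.log_rpow hq0] at this
  have hlogX0 : 0 < Real.log X := by linarith only [hlogX, hlogq0]
  have hV : (37 / 4 : ℝ) ≤ V := by rw [hVdef, le_div_iff₀ hlogq0]; exact hlogX
  have hV1 : 1 ≤ V := by linarith
  have hV0 : 0 < V := by linarith
  have hlogXeq : Real.log X = V * Real.log q := by rw [hVdef]; field_simp
  have hXexp : X = Real.exp (Real.log X) := (Real.exp_log hX0).symm
  -- `S = √(Vℓ)`
  set S : ℝ := Real.sqrt (V * ℓ) with hSdef
  have hVℓ0 : 0 < V * ℓ := mul_pos hV0 hℓ0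
  have hS0 : 0 < S := Real.sqrt_pos.mpr hVℓ0
  have hS2 : S ^ 2 = V * ℓ := Real.sq_sqrt hVℓ0.le
  have hSℓ : (37 / 4) * ℓ ≤ S ^ 2 := by rw [hS2]; nlinarith only [hV, hℓ0]
  -- `T`
  have hT1 : Real.exp (-(C * S)) ≤ T := by
    rw [hTdef]; have : 0 ≤ V * ℓ ^ 6 / η := by positivity
    linarith
  have hVℓ6 : V * ℓ ^ 6 / η ≤ T := by rw [hTdef]; linarith [(Real.exp_pos (-(C * S))).le]
  have hT2 : Real.exp (-ℓ) ≤ T := by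
    refine le_trans ?_ hVℓ6
    have h1 : Real.exp (-ℓ) = 1 / η := by rw [hηexp, Real.exp_neg, one_div]
    rw [h1]
    refine div_le_div_of_nonneg_right ?_ hη0.le
    have : (1 : ℝ) ≤ ℓ ^ 6 := one_le_pow₀ hℓ1
    nlinarith only [this, hV1]
  have hT0 : 0 < T := lt_of_lt_of_le (Real.exp_pos _) hT2
  -- `u`
  have huℓ : u ≤ ℓ := by rw [hudef]; exact min_le_right _ _
  have h10C : 0 < 10 * C := by positivity
  have hSC : 2 ≤ S / (10 * C) ∧ u₀ ≤ S / (10 * C) := by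
    have hpos : 0 ≤ S / (10 * C) := by positivity
    have hden : (0 : ℝ) < (10 * C) ^ 2 := by positivity
    have hℓb : 44 * C ^ 2 + 11 * C ^ 2 * u₀ ^ 2 ≤ ℓ := by linarith
    have h100 : (10 * C) ^ 2 = 100 * C ^ 2 := by ring
    have hCu : 0 ≤ C ^ 2 * u₀ ^ 2 := by positivity
    have hsq4 : 4 ≤ (S / (10 * C)) ^ 2 := by
      rw [div_pow, le_div_iff₀ hden, h100]; linarith only [hSℓ, hℓb, hCu, hC2]
    have hsqu : u₀ ^ 2 ≤ (S / (10 * C)) ^ 2 := by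
      rw [div_pow, le_div_iff₀ hden, h100]; nlinarith only [hSℓ, hℓb, hCu, hC2, sq_nonneg u₀]
    constructor
    · nlinarith only [hsq4, hpos]
    · by_cases hu₀ : u₀ ≤ 0
      · linarith
      · push Not at hu₀
        exact (pow_le_pow_iff_left₀ hu₀.le hpos two_ne_zero).mp hsqu
  have hu₀ℓ : u₀ ≤ ℓ := by
    have h1 : u₀ ≤ 2 + 11 * u₀ ^ 2 := by nlinarith only [sq_nonneg (u₀ - 1), sq_nonneg u₀]
    have h2 : 11 * u₀ ^ 2 ≤ 11 * C ^ 2 * u₀ ^ 2 := by nlinarith only [hC2, sq_nonneg u₀]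
    linarith only [h1, h2, hℓℓ₀, hℓ₀, sq_nonneg C]
  -- `rpow` in exponential form
  have hXrpow : ∀ y : ℝ, X ^ y = Real.exp (Real.log X * y) := fun y => Real.rpow_def_of_pos hX0 y
  have hηrpow : ∀ y : ℝ, η ^ y = Real.exp (ℓ * y) := fun y => by rw [Real.rpow_def_of_pos hη0, ← hℓdef]
  -- the scaling `M e^{-…} ≤ K T`
  have hKT : ∀ {a M : ℝ}, (a ≤ M * Real.exp (-ℓ) ∨ a ≤ M * Real.exp (-(C * S))) → 0 ≤ M → M ≤ K →
      a ≤ K * T := by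
    intro a M h hM hMK
    rcases h with h | h
    · exact h.trans ((mul_le_mul_of_nonneg_left hT2 hM).trans (mul_le_mul_of_nonneg_right hMK hT0.le))
    · exact h.trans ((mul_le_mul_of_nonneg_left hT1 hM).trans (mul_le_mul_of_nonneg_right hMK hT0.le))
  ------------------------------------------------------------------
  -- regime split: obtain `u`'s value and the five regime bounds in the form `≤ M·decay`
  ------------------------------------------------------------------
  have hreg : u₀ ≤ u ∧ 2 ≤ u ∧
      (u ^ 8 * ((V ^ 2)⁻¹ * Real.exp (-(ℓ * (V / (3 * u))))) ≤ K * T ∧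
       u ^ 10 * Real.exp (Real.log X * (-(1 / (2 * u)))) ≤ K * T ∧
       u ^ 6 * Real.exp (Real.log X * (-(1 / u))) ≤ K * T ∧
       Real.exp (-(10 ^ 6 * C ^ 2 * u / 3000)) ≤ K * T ∧
       u ^ 4 / ((V / u) ^ 2 * Real.exp (ℓ * (V / u / 2))) ≤ K * T) := by
    rcases le_or_gt (S / (10 * C)) ℓ with hA | hB
    · -- regime A
      have hu : u = S / (10 * C) := by rw [hudef, min_eq_left hA]
      have hu0 : 0 < u := by rw [hu]; positivity
      have hVu : V / u = 10 * C * S / ℓ := by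
        rw [hu]
        have : V = S ^ 2 / ℓ := by rw [hS2]; field_simp
        rw [this]; field_simp
      have hLu : 1000 * C * S ≤ Real.log X / u := by
        rw [hlogXeq, show V * Real.log q / u = (V / u) * Real.log q by ring, hVu]
        have h1 : (100 : ℝ) ≤ Real.log q / ℓ := by rw [le_div_iff₀ hℓ0]; linarith
        have h2 : 10 * C * S / ℓ * Real.log q = 10 * C * S * (Real.log q / ℓ) := by field_simp
        rw [h2]
        nlinarith only [h1, mul_pos h10C hS0]
      obtain ⟨b1, b2, b3, b4, b5⟩ := regimeA_bounds hC hS0 hℓ0 hV hS2 hu hLu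
      refine ⟨hu ▸ hSC.2, hu ▸ hSC.1, ?_, ?_, ?_, ?_, ?_⟩
      · exact hKT (Or.inr b1) (by positivity) (by rw [f8, hK]; norm_num)
      · exact hKT (Or.inr b2) (by positivity) (by rw [f10, hK]; norm_num)
      · exact hKT (Or.inr b3) (by positivity) (by rw [f6, hK]; norm_num)
      · exact hKT (Or.inr (by rw [one_mul]; exact b4)) zero_le_one (by rw [hK]; norm_num)
      · exact hKT (Or.inr b5) (by positivity) (by rw [f6, hK]; norm_num)
    · -- regime B
      have hu : u = ℓ := by rw [hudef, min_eq_right hB.le]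
      have hSℓ' : 10 * C * ℓ < S := by rwa [lt_div_iff₀ h10C, mul_comm] at hB
      have hVℓ : 100 * C ^ 2 * ℓ ≤ V := by
        have h1 : (10 * C * ℓ) ^ 2 < S ^ 2 := pow_lt_pow_left₀ hSℓ' (by positivity) (by norm_num)
        rw [hS2] at h1
        nlinarith only [h1, hℓ0]
      have hLu : 10000 * C ^ 2 * ℓ ≤ Real.log X / u := by
        rw [hu, hlogXeq, le_div_iff₀ hℓ0]
        have := mul_le_mul hVℓ hlq (by positivity) hV0.le
        nlinarith only [this]
      obtain ⟨b1, b2, b3, b4, b5⟩ := regimeB_bounds hC hℓ1 hu hVℓ hLu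
      simp only [one_mul] at b1 b2 b3 b4 b5
      refine ⟨hu ▸ hu₀ℓ, hu ▸ hℓ2, ?_, ?_, ?_, ?_, ?_⟩
      · exact hKT (Or.inl b1) (by positivity) (by rw [f8, hK]; norm_num)
      · exact hKT (Or.inl b2) (by positivity) (by rw [f10, hK]; norm_num)
      · exact hKT (Or.inl b3) (by positivity) (by rw [f6, hK]; norm_num)
      · exact hKT (Or.inl (by rw [one_mul]; exact b4)) zero_le_one (by rw [hK]; norm_num)
      · exact hKT (Or.inl b5) (by positivity) (by rw [f4, hK]; norm_num)
  obtain ⟨huu₀, hu2, c1, c3, c6, c5, c8a⟩ := hreg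
  have hu0 : 0 < u := by linarith
  ------------------------------------------------------------------
  -- the regime-independent bounds
  ------------------------------------------------------------------
  -- (c2) `u⁶ V/η ≤ V ℓ⁶/η ≤ T`
  have hTK : T ≤ K * T := by rw [hK]; nlinarith only [hT0]
  have c2 : u ^ 6 * V / η ≤ K * T := by
    have h1 : u ^ 6 * V / η ≤ V * ℓ ^ 6 / η := by
      refine div_le_div_of_nonneg_right ?_ hη0.le
      have := pow_le_pow_left₀ hu0.le huℓ 6
      nlinarith only [this, hV0]
    linarith only [h1, hVℓ6, hTK]
  -- (c8b) `(V/u) u⁵/η = V u⁴/η ≤ V ℓ⁶/η ≤ T`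
  have c8b : V / u * u ^ 5 / η ≤ K * T := by
    have e : V / u * u ^ 5 / η = V * u ^ 4 / η := by field_simp
    rw [e]
    have h1 : V * u ^ 4 / η ≤ V * ℓ ^ 6 / η := by
      refine div_le_div_of_nonneg_right ?_ hη0.le
      have hu4 : u ^ 4 ≤ ℓ ^ 4 := pow_le_pow_left₀ hu0.le huℓ 4
      have hℓ46 : ℓ ^ 4 ≤ ℓ ^ 6 := pow_le_pow_right₀ hℓ1 (by norm_num)
      nlinarith only [hu4, hℓ46, hV0]
    linarith only [h1, hVℓ6, hTK]
  -- (c10) `u⁴/√q ≤ ℓ⁴ e^{−50ℓ} ≤ 4! e^{−ℓ}`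
  have c10 : u ^ 4 / Real.sqrt q ≤ K * T := by
    have hsqrt : Real.sqrt q = Real.exp (Real.log q / 2) := by
      rw [Real.sqrt_eq_rpow, Real.rpow_def_of_pos hq0]; ring_nf
    have h1 : u ^ 4 / Real.sqrt q ≤ (Nat.factorial 4 : ℝ) * Real.exp (-(1 * ℓ)) := by
      rw [hsqrt, div_eq_mul_inv, ← Real.exp_neg]
      exact pow_mul_exp_le_of_le 4 hu0.le huℓ (by linarith only [hlq, hℓ0])
    rw [one_mul] at h1
    exact hKT (Or.inl h1) (by positivity) (by rw [f4, hK]; norm_num)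
  -- (c7)
  have c7 : X ^ (-(2 : ℝ) / 9 + 3 / 1000) * (q : ℝ) ^ 2 ≤ K * T := by
    have e1 : X ^ (-(2 : ℝ) / 9 + 3 / 1000) * (q : ℝ) ^ 2 =
        Real.exp (Real.log q * ((-(2 : ℝ) / 9 + 3 / 1000) * V + 2)) := by
      have hq2 : ((q : ℝ)) ^ 2 = Real.exp (Real.log q * 2) := by
        rw [← Real.rpow_def_of_pos hq0, show (2 : ℝ) = ((2 : ℕ) : ℝ) by norm_num, Real.rpow_natCast]
      rw [hXrpow, hlogXeq, hq2, ← Real.exp_add]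
      congr 1; ring
    rw [e1]
    have h1 := geometric_term_le hlq hℓ0.le hV
    exact hKT (Or.inl (by rw [one_mul]; exact h1)) zero_le_one (by rw [hK]; norm_num)
  -- (c4)
  have c4 : (X ^ (1 / u) + Real.log q) * Real.log X ^ 2 ≤ K * T * X := by
    have h4ℓ : 4 * ℓ ≤ Real.log X := by linarith only [hlogX, hlq, hℓ0]
    have hlqX : Real.log q ≤ Real.log X := by linarith only [hlogX, hlogq0]
    have h1 := level_term_le hXexp hlogX0.le hu2 h4ℓ hlqX
    rw [← hXrpow] at h1
    calc _ ≤ 80 * Real.exp (-ℓ) * X := h1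
      _ ≤ 80 * T * X := by gcongr
      _ ≤ K * T * X := by rw [hK]; gcongr; norm_num
  -- translate the regime bounds back to `rpow` form and conclude
  refine ⟨huu₀, hu0, huℓ, ?_, c2, ?_, ?_, c5, ?_, c7, ?_, c8b, c10⟩
  · rw [hηrpow, div_eq_mul_inv, mul_inv, ← Real.exp_neg]; exact c1
  · rw [hXrpow]; exact c3
  · exact c4
  · rw [hXrpow]; exact c6
  · rw [hηrpow]; exact c8a


/-! ### One more error term: `log q / z` -/

/-- **The term `log q / z`** (needed for the `(7.3)` error `k_q/z ≤ ω(q)/z`): under the standing hypotheses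
of `MatomakiMerikoski2023_parameters` and `u ≥ 1`, `log q / X^{1/u} ≤ u^{10} X^{−1/(2u)}` (which the main
theorem bounds by `K·T`).  Indeed `u ≤ √(Vℓ)/(10C)` gives `log X/u ≥ 100 C √V √(log q) ≥ 4√(log q) ≥ 2 log log q`, so
`log q ≤ √z`. [cite: MatomakiMerikoski2023, §7 (7.2)–(7.3)] -/
theorem log_div_level_le {C : ℝ} (hC : 1 ≤ C) {q : ℕ} (hq : 3 ≤ q) {η X V ℓ u : ℝ} (hη : 1 < η)
    (hℓ : ℓ = Real.log η) (hℓq : Real.log η ≤ Real.log q / 100) (hX : (q : ℝ) ^ (37 / 4 : ℝ) ≤ X)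
    (hV : V = Real.log X / Real.log q) (hu : u = min (Real.sqrt (V * ℓ) / (10 * C)) ℓ) (hu1 : 1 ≤ u) :
    Real.log q / X ^ (1 / u) ≤ u ^ 10 * X ^ (-(1 / (2 * u))) := by
  have hq3 : (3 : ℝ) ≤ q := by exact_mod_cast hq
  have hq0 : (0 : ℝ) < q := by linarith
  have hlogq : 1 < Real.log q := by
    rw [Real.lt_log_iff_exp_lt hq0]
    exact lt_of_lt_of_le (by have := Real.exp_one_lt_d9; norm_num at this ⊢; linarith) hq3
  have hlogq0 : 0 < Real.log q := by linarith
  have hℓ0 : 0 < ℓ := by rw [hℓ]; exact Real.log_pos hη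
  have hu0 : 0 < u := by linarith
  have hXq : (q : ℝ) ^ (37 / 4 : ℝ) ≤ X := hX
  have hX0 : 0 < X := lt_of_lt_of_le (by positivity) hXq
  have hlogX : 37 / 4 * Real.log q ≤ Real.log X := by
    have := Real.log_le_log (by positivity) hXq
    rwa [Real.log_rpow hq0] at this
  have hV94 : 37 / 4 ≤ V := by rw [hV, le_div_iff₀ hlogq0]; exact hlogX
  have hV0 : 0 < V := by linarith
  have hC0 : 0 < C := by linarith
  -- `u ≤ √(Vℓ)/(10C)` hence `log X / u ≥ 10 C log X/√(Vℓ) = 10 C √V log q/√ℓ ≥ 100 C √V √(log q)`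
  have huA : u ≤ Real.sqrt (V * ℓ) / (10 * C) := by rw [hu]; exact min_le_left _ _
  have hsVℓ : 0 < Real.sqrt (V * ℓ) := Real.sqrt_pos.mpr (by positivity)
  have hLu : 100 * C * Real.sqrt V * Real.sqrt (Real.log q) ≤ Real.log X / u := by
    rw [le_div_iff₀ hu0]
    have hlogXe : Real.log X = V * Real.log q := by rw [hV]; field_simp
    -- `100 C √V √(log q) · u ≤ 100 C √V √(log q) · √(Vℓ)/(10C) = 10 √V √(log q) √V √ℓ = 10 V √(ℓ log q)`
    calc 100 * C * Real.sqrt V * Real.sqrt (Real.log q) * u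
        ≤ 100 * C * Real.sqrt V * Real.sqrt (Real.log q) * (Real.sqrt (V * ℓ) / (10 * C)) :=
          mul_le_mul_of_nonneg_left huA (by positivity)
      _ = 10 * (Real.sqrt V * Real.sqrt V) * (Real.sqrt (Real.log q) * Real.sqrt ℓ) := by
          rw [Real.sqrt_mul hV0.le]; field_simp; ring
      _ = 10 * V * Real.sqrt (Real.log q * ℓ) := by
          rw [Real.mul_self_sqrt hV0.le, ← Real.sqrt_mul hlogq0.le]
      _ ≤ 10 * V * Real.sqrt (Real.log q * (Real.log q / 100)) := by
          gcongr; rw [hℓ]; exact hℓq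
      _ = V * Real.log q := by
          rw [show Real.log q * (Real.log q / 100) = (Real.log q / 10) ^ 2 by ring,
            Real.sqrt_sq (by positivity)]; ring
      _ = Real.log X := hlogXe.symm
  -- hence `log X/(2u) ≥ 50 C √V √(log q) ≥ 150 √(log q) ≥ log (log q)` i.e. `log q ≤ √z`
  have hsqrtV : 3 ≤ Real.sqrt V := by
    rw [show (3 : ℝ) = Real.sqrt 9 by rw [show (9:ℝ) = 3 ^ 2 by norm_num, Real.sqrt_sq (by norm_num)]]
    exact Real.sqrt_le_sqrt (by linarith [hV94])
  have hll : Real.log (Real.log q) ≤ Real.log X / (2 * u) := by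
    have h1 : Real.log (Real.log q) ≤ 2 * Real.sqrt (Real.log q) := by
      -- `log t ≤ 2√t` (cf. `DFI1995.log_le_two_mul_sqrt`; inlined to keep the import closure small)
      have h := Real.log_le_rpow_div hlogq0.le (by norm_num : (0 : ℝ) < 1 / 2)
      rw [← Real.sqrt_eq_rpow] at h
      linarith
    have h2 : 2 * Real.sqrt (Real.log q) ≤ 50 * C * Real.sqrt V * Real.sqrt (Real.log q) := by
      have : (2 : ℝ) ≤ 50 * C * Real.sqrt V := by nlinarith
      nlinarith [Real.sqrt_nonneg (Real.log q)]
    have h3 : Real.log X / (2 * u) = (Real.log X / u) / 2 := by field_simp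
    rw [h3]; linarith
  have hsqrt_z : Real.log q ≤ X ^ (1 / (2 * u)) := by
    calc Real.log q = Real.exp (Real.log (Real.log q)) := (Real.exp_log hlogq0).symm
      _ ≤ Real.exp (Real.log X / (2 * u)) := Real.exp_le_exp.mpr hll
      _ = X ^ (1 / (2 * u)) := by rw [Real.rpow_def_of_pos hX0]; congr 1; field_simp
  -- `log q / z ≤ z^{1/2}/z = z^{−1/2} ≤ u^{10} z^{−1/2}`
  have hz_split : X ^ (1 / u) = X ^ (1 / (2 * u)) * X ^ (1 / (2 * u)) := by
    rw [← Real.rpow_add hX0]; congr 1; field_simp; ring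
  have hzh0 : 0 < X ^ (1 / (2 * u)) := Real.rpow_pos_of_pos hX0 _
  have hneg : X ^ (-(1 / (2 * u))) = (X ^ (1 / (2 * u)))⁻¹ := Real.rpow_neg hX0.le _
  rw [hz_split, hneg, div_le_iff₀ (by positivity)]
  have hu10 : (1 : ℝ) ≤ u ^ 10 := one_le_pow₀ hu1
  calc Real.log q ≤ X ^ (1 / (2 * u)) := hsqrt_z
    _ = 1 * ((X ^ (1 / (2 * u)))⁻¹ * (X ^ (1 / (2 * u)) * X ^ (1 / (2 * u)))) := by field_simp
    _ ≤ u ^ 10 * ((X ^ (1 / (2 * u)))⁻¹ * (X ^ (1 / (2 * u)) * X ^ (1 / (2 * u)))) :=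
        mul_le_mul_of_nonneg_right hu10 (by positivity)
    _ = u ^ 10 * (X ^ (1 / (2 * u)))⁻¹ * (X ^ (1 / (2 * u)) * X ^ (1 / (2 * u))) := by ring

end Literature.Barriers.Parity.MatomakiMerikoski
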